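import Summits.NavierStokesRegularity.FluidComputer.TriggeredTransfer

/-!
# Fluid computer, door N1-FC — steady Euler pairs and the TRANSPLANT between two disjointly supported blobs

Cell `ns-blowup`, seat `ns-blowup-fc-prover-1` (g3; D-0074 GROUP C «bridge support»; LADDER-NS rung
N1-FC). First of three files (`TriggeredTransferTransplant` → `TriggeredTransferSteadyBlob` →
`TriggeredTransferEulerInstance`) proving that the door's static type `TriggerScheme` and its
one-step predicate `TriggerScheme.Step` (`TriggeredTransfer.lean`, seat `ns-blowup-fc-route`) are
INHABITED — at `ν = 0` with a UNIT trigger, by a prescribed forced Euler flow. LABEL: E–C typing /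
calibration. WHAT THIS IS NOT: not Navier–Stokes evidence; every flow here is PRESCRIBED and paid for
by its force; no transfer by any fluid and nothing about `Transfers ν` is claimed.

## Contents (theorems only)

* `isClassicalNSSolutionOn_steady` / `convect_add_gradient_eq_zero_of_steady` — a smooth steady
  Euler pair `(W, Q)` (`div W = 0`, `(W·∇)W + ∇Q = 0`) is exactly a time-independent classical
  solution of the incompressible system with `ν = 0`, `f = 0`, on any time set;
* `steady_zoom` — amplitude scaling and the zoom `x ↦ a • W (b • (x - x₀))`, pressure
  `a² • Q (b • (x - x₀))`, preserve steadiness (the tree's `IsClassicalNSSolutionOn.stRescale`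
  [cite: Leray1934, §20] at viscosity `a · 0 / b = 0`);
* `convect_transplant` — for differentiable `W₁`, `W₂` with DISJOINT supports,
  `((aW₁ + bW₂)·∇)(aW₁ + bW₂) = a² (W₁·∇)W₁ + b² (W₂·∇)W₂` (at every point one field vanishes to
  all orders); `gradient_transplant` — linearity of `∇`;
* `isClassicalNSSolutionOn_transplant` — THE TRANSPLANT: for two smooth steady Euler pairs with
  disjointly supported velocities and any smooth `θ : ℝ → ℝ`, `u t = (1 - θ t) • W₁ + θ t • W₂`,
  `p t = (1 - θ t)² • Q₁ + (θ t)² • Q₂` is a classical solution of the EULER system forced by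
  `g t = θ′(t) • (W₂ - W₁)` on every time set of unique differentiability: `∂ₜu = g` and
  `(u·∇)u + ∇p = 0`. The force is exactly the time derivative — the fluid does no work of its own
  (compare the "junk stage" `a(t)V(x)` killed on route `PalasekTowerBreakdown` by
  `Stage.false_of_separable`; the door `TriggeredTransfer` has no such pin at unit trigger size).

0 sorry; axioms ⊆ {propext, Classical.choice, Quot.sound}. References: J. Leray, Acta Math. 63 (1934)
§20 [cite: Leray1934, §20]; T. Tao, J. Amer. Math. Soc. 29 (2016) §1.3 [cite: Tao2016AveragedNS, §1.3].
-/

noncomputable section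

namespace Summit.NavierStokesRegularity.FluidComputer.TriggeredTransfer

open Set MeasureTheory Function Filter Metric
open scoped ENNReal ContDiff NNReal Topology
open Literature.Analysis.FluidPDE
open Literature.Analysis.FluidPDE.FluidComputer (E3 Vel)

/-! ## Steady Euler pairs as classical solutions; scaling and zoom -/

/-- A smooth steady Euler pair `(W, Q)` — `div W = 0`, `(W·∇)W + ∇Q = 0` pointwise — is a
time-independent classical solution of the incompressible system with `ν = 0` and zero force on
every time set `S`. [folklore] -/
theorem isClassicalNSSolutionOn_steady (S : Set ℝ) {W : Vel} {Q : E3 → ℝ} (hW : ContDiff ℝ ∞ W)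
    (hQ : ContDiff ℝ ∞ Q) (hdiv : VectorCalculus.IsDivFree W)
    (hE : ∀ x, convect W W x + gradient Q x = 0) :
    IsClassicalNSSolutionOn S 0 0 (fun _ : ℝ => W) (fun _ : ℝ => Q) where
  smooth_velocity := (hW.comp contDiff_snd).contDiffOn
  smooth_pressure := (hQ.comp contDiff_snd).contDiffOn
  momentum t _ x := by
    have h0 : timeDerivWithin S (fun _ : ℝ => W) t x = 0 := by
      simp [timeDerivWithin]
    rw [h0, zero_add, zero_smul, zero_sub, Pi.zero_apply, Pi.zero_apply, add_zero]
    exact eq_neg_of_add_eq_zero_left (hE x)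
  divFree _ _ := hdiv

/-- Conversely, a time-independent classical solution with `ν = 0` and zero force on a nonempty
time set is a steady Euler pair. [folklore] -/
theorem convect_add_gradient_eq_zero_of_steady {S : Set ℝ} {t : ℝ} (ht : t ∈ S) {W : Vel}
    {Q : E3 → ℝ} (h : IsClassicalNSSolutionOn S 0 0 (fun _ : ℝ => W) (fun _ : ℝ => Q)) (x : E3) :
    convect W W x + gradient Q x = 0 := by
  have hm := h.momentum t ht x
  have h0 : timeDerivWithin S (fun _ : ℝ => W) t x = 0 := by
    simp [timeDerivWithin]
  rw [h0, zero_add, zero_smul, zero_sub, Pi.zero_apply, Pi.zero_apply, add_zero] at hm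
  rw [hm, neg_add_cancel]

/-- **Amplitude scaling and zoom preserve steadiness**: if `(W, Q)` is a smooth steady Euler pair
then so is `(x ↦ a • W (b • (x - x₀)), x ↦ a² • Q (b • (x - x₀)))` for `a, b > 0` — the case
`α = a`, `γ = b`, `t₀ = 0` of the tree's space–time rescaling covariance
`IsClassicalNSSolutionOn.stRescale` (viscosity `a · 0 / b = 0`). [folklore] -/
theorem steady_zoom {W : Vel} {Q : E3 → ℝ} (hW : ContDiff ℝ ∞ W) (hQ : ContDiff ℝ ∞ Q)
    (hdiv : VectorCalculus.IsDivFree W) (hE : ∀ x, convect W W x + gradient Q x = 0) {a b : ℝ}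
    (ha : 0 < a) (hb : 0 < b) (x₀ : E3) :
    VectorCalculus.IsDivFree (fun x => a • W (b • (x - x₀))) ∧
      ∀ x, convect (fun y => a • W (b • (y - x₀))) (fun y => a • W (b • (y - x₀))) x +
        gradient (fun y => a ^ 2 • Q (b • (y - x₀))) x = 0 := by
  have h := (isClassicalNSSolutionOn_steady univ hW hQ hdiv hE).stRescale ha hb rfl 0 (-(b • x₀))
  have hu : (a • stPull (a * b) b 0 (-(b • x₀)) (fun _ : ℝ => W)) =
      fun _ : ℝ => fun y => a • W (b • (y - x₀)) := by
    funext s y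
    simp only [Pi.smul_apply, stPull_apply, smul_sub, neg_add_eq_sub]
  have hp : (a ^ 2 • stPull (a * b) b 0 (-(b • x₀)) (fun _ : ℝ => Q)) =
      fun _ : ℝ => fun y => a ^ 2 • Q (b • (y - x₀)) := by
    funext s y
    simp only [Pi.smul_apply, stPull_apply, smul_sub, neg_add_eq_sub]
  rw [Set.preimage_univ, mul_zero, zero_div, smul_stPull_zero, hu, hp] at h
  exact ⟨h.divFree 0 (mem_univ _), convect_add_gradient_eq_zero_of_steady (mem_univ (0 : ℝ)) h⟩

/-! ## The transplant between two disjointly supported steady blobs -/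

/-- **The cross terms vanish.** For differentiable fields `W₁`, `W₂` with disjoint (topological)
supports, `((aW₁ + bW₂)·∇)(aW₁ + bW₂) = a² (W₁·∇)W₁ + b² (W₂·∇)W₂` pointwise: at every point one
of the two fields vanishes identically near the point, so its value and its derivative vanish there.
[folklore] -/
theorem convect_transplant {W₁ W₂ : Vel} (hW₁ : Differentiable ℝ W₁) (hW₂ : Differentiable ℝ W₂)
    (hdisj : Disjoint (tsupport W₁) (tsupport W₂)) (a b : ℝ) (x : E3) :
    convect (fun y => a • W₁ y + b • W₂ y) (fun y => a • W₁ y + b • W₂ y) x =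
      a ^ 2 • convect W₁ W₁ x + b ^ 2 • convect W₂ W₂ x := by
  simp only [convect_apply]
  have ha : DifferentiableAt ℝ (fun y => a • W₁ y) x := (hW₁ x).const_smul a
  have hb : DifferentiableAt ℝ (fun y => b • W₂ y) x := (hW₂ x).const_smul b
  rw [fderiv_fun_add ha hb, fderiv_fun_const_smul (hW₁ x), fderiv_fun_const_smul (hW₂ x)]
  by_cases hx : x ∈ tsupport W₁
  · -- then `x ∉ tsupport W₂`: `W₂` vanishes near `x`
    have hx₂ : x ∉ tsupport W₂ := Set.disjoint_left.mp hdisj hx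
    have h2 : W₂ =ᶠ[𝓝 x] 0 := notMem_tsupport_iff_eventuallyEq.mp hx₂
    have hf2 : fderiv ℝ W₂ x = 0 := by rw [h2.fderiv_eq, fderiv_zero]; rfl
    have hv2 : W₂ x = 0 := h2.eq_of_nhds
    simp [hf2, hv2, smul_smul, sq]
  · have h1 : W₁ =ᶠ[𝓝 x] 0 := notMem_tsupport_iff_eventuallyEq.mp hx
    have hf1 : fderiv ℝ W₁ x = 0 := by rw [h1.fderiv_eq, fderiv_zero]; rfl
    have hv1 : W₁ x = 0 := h1.eq_of_nhds
    simp [hf1, hv1, smul_smul, sq]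

/-- `∇(a Q₁ + b Q₂) = a ∇Q₁ + b ∇Q₂` pointwise for differentiable `Q₁`, `Q₂`. [folklore] -/
theorem gradient_transplant {Q₁ Q₂ : E3 → ℝ} (h₁ : Differentiable ℝ Q₁) (h₂ : Differentiable ℝ Q₂)
    (a b : ℝ) (x : E3) :
    gradient (fun y => a • Q₁ y + b • Q₂ y) x = a • gradient Q₁ x + b • gradient Q₂ x := by
  have ha : DifferentiableAt ℝ (fun y => a • Q₁ y) x := (h₁ x).const_smul a
  have hb : DifferentiableAt ℝ (fun y => b • Q₂ y) x := (h₂ x).const_smul b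
  rw [gradient, fderiv_fun_add ha hb, map_add, ← gradient, ← gradient, gradient_const_smul (h₁ x),
    gradient_const_smul (h₂ x)]

/-- **THE TRANSPLANT** (a prescribed forced Euler flow). Let `(W₁, Q₁)`, `(W₂, Q₂)` be smooth
steady Euler pairs whose velocity fields have DISJOINT supports, and let `θ : ℝ → ℝ` be smooth. Then
`u t = (1 - θ t) • W₁ + θ t • W₂`, `p t = (1 - θ t)² • Q₁ + (θ t)² • Q₂` is a classical solution, on
every time set, of the incompressible EULER system (`ν = 0`) forced by `g t = θ′(t) • (W₂ - W₁)`: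
`∂ₜu = g`, and `(u·∇)u + ∇p = (1-θ)² ((W₁·∇)W₁ + ∇Q₁) + θ² ((W₂·∇)W₂ + ∇Q₂) = 0` by
`convect_transplant`. The force is exactly the time derivative: the fluid does no work of its own.
[folklore] -/
theorem isClassicalNSSolutionOn_transplant {W₁ W₂ : Vel} {Q₁ Q₂ : E3 → ℝ}
    (hW₁ : ContDiff ℝ ∞ W₁) (hW₂ : ContDiff ℝ ∞ W₂) (hQ₁ : ContDiff ℝ ∞ Q₁) (hQ₂ : ContDiff ℝ ∞ Q₂)
    (hd₁ : VectorCalculus.IsDivFree W₁) (hd₂ : VectorCalculus.IsDivFree W₂)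
    (hE₁ : ∀ x, convect W₁ W₁ x + gradient Q₁ x = 0)
    (hE₂ : ∀ x, convect W₂ W₂ x + gradient Q₂ x = 0)
    (hdisj : Disjoint (tsupport W₁) (tsupport W₂)) {θ : ℝ → ℝ} (hθ : ContDiff ℝ ∞ θ)
    {S : Set ℝ} (hS : UniqueDiffOn ℝ S) :
    IsClassicalNSSolutionOn S 0 (fun t x => deriv θ t • (W₂ x - W₁ x))
      (fun t x => (1 - θ t) • W₁ x + θ t • W₂ x)
      (fun t x => (1 - θ t) ^ 2 • Q₁ x + θ t ^ 2 • Q₂ x) := by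
  have hW₁d : Differentiable ℝ W₁ := hW₁.differentiable (by simp)
  have hW₂d : Differentiable ℝ W₂ := hW₂.differentiable (by simp)
  have hQ₁d : Differentiable ℝ Q₁ := hQ₁.differentiable (by simp)
  have hQ₂d : Differentiable ℝ Q₂ := hQ₂.differentiable (by simp)
  have hθd : Differentiable ℝ θ := hθ.differentiable (by simp)
  -- the solution on the whole time line; then restrict
  have huniv : IsClassicalNSSolutionOn (univ : Set ℝ) 0 (fun t x => deriv θ t • (W₂ x - W₁ x))
      (fun t x => (1 - θ t) • W₁ x + θ t • W₂ x)
      (fun t x => (1 - θ t) ^ 2 • Q₁ x + θ t ^ 2 • Q₂ x) :=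
    { smooth_velocity := by
        have h : ContDiff ℝ ∞ fun z : ℝ × E3 => (1 - θ z.1) • W₁ z.2 + θ z.1 • W₂ z.2 :=
          ((contDiff_const.sub (hθ.comp contDiff_fst)).smul (hW₁.comp contDiff_snd)).add
            ((hθ.comp contDiff_fst).smul (hW₂.comp contDiff_snd))
        exact h.contDiffOn
      smooth_pressure := by
        have h : ContDiff ℝ ∞ fun z : ℝ × E3 => (1 - θ z.1) ^ 2 • Q₁ z.2 + θ z.1 ^ 2 • Q₂ z.2 :=
          (((contDiff_const.sub (hθ.comp contDiff_fst)).pow 2).smul (hQ₁.comp contDiff_snd)).add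
            (((hθ.comp contDiff_fst).pow 2).smul (hQ₂.comp contDiff_snd))
        exact h.contDiffOn
      momentum := by
        intro t _ x
        -- time derivative
        have hder : HasDerivAt (fun s => (1 - θ s) • W₁ x + θ s • W₂ x)
            ((0 - deriv θ t) • W₁ x + deriv θ t • W₂ x) t :=
          (((hasDerivAt_const t (1 : ℝ)).sub (hθd t).hasDerivAt).smul_const (W₁ x)).add
            ((hθd t).hasDerivAt.smul_const (W₂ x))
        have htime : timeDerivWithin (univ : Set ℝ) (fun t x => (1 - θ t) • W₁ x + θ t • W₂ x) t x =
            deriv θ t • (W₂ x - W₁ x) := by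
          rw [timeDerivWithin_apply, derivWithin_univ, hder.deriv, zero_sub, smul_sub, neg_smul]
          abel
        rw [htime, convect_transplant hW₁d hW₂d hdisj, gradient_transplant hQ₁d hQ₂d, zero_smul,
          zero_sub]
        have e₁ : convect W₁ W₁ x = -gradient Q₁ x := eq_neg_of_add_eq_zero_left (hE₁ x)
        have e₂ : convect W₂ W₂ x = -gradient Q₂ x := eq_neg_of_add_eq_zero_left (hE₂ x)
        rw [e₁, e₂, smul_neg, smul_neg, neg_add, add_comm]
      divFree := by
        intro t _ y
        have ha : DifferentiableAt ℝ (fun z => (1 - θ t) • W₁ z) y := (hW₁d y).const_smul (1 - θ t)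
        have hb : DifferentiableAt ℝ (fun z => θ t • W₂ z) y := (hW₂d y).const_smul (θ t)
        rw [divergence_add_apply ha hb, divergence_const_smul_apply (hW₁d y),
          divergence_const_smul_apply (hW₂d y), hd₁ y, hd₂ y, mul_zero, mul_zero, add_zero] }
  exact huniv.mono (subset_univ S) hS

end Summit.NavierStokesRegularity.FluidComputer.TriggeredTransfer

end
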